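import Summits.BirchSwinnertonDyer.BirchSwinnertonDyer.Theorems.PrintX9StabilizedClassOfKolyvaginSystemLeaf
import Literature.NumberTheory.EllipticCurves.RingClassFieldTower
import Literature.NumberTheory.EllipticCurves.IwasawaAlgebraEisensteinTorsionExactProofs
import Literature.NumberTheory.EllipticCurves.HeegnerGeomCoherentDataOfFrameProofs
import Literature.NumberTheory.GaloisCohomology.Howard2004.DVRKolyvaginBoundPrintIntended
import HarnessLib

/-!
# (T-161′, KS road) The μ-road below Howard's Thm. 1.6.1 re-derived against the PRINT-AS-INTENDED leaf F-161′:
# `portCyclic_of_ks`, the L∃ letter (crux 22642's text) and the strengthened coherent-pair letter from F-161′ + F-411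

Summits-side, THEOREMS ONLY (no named fact, no instance, no `sorry`). Cell `pub/bsd-print-x9`, seat `bsd-line-x9-p1` LEAD g10,
`--supports` stmt-BirchSwinnertonDyer-22642 (whose `stub_h161` is the print leaf F-161); pen plan g15 TURNKEY T-161′ (2026-08-29T08:35:01Z),
referee REF-167 «HD-STANDING» / REF-169 «HP0-STANDING».

WHY. The tree APPLIES the cite-only leaf F-161 `Howard2004.thm161_dvrKolyvaginBound` (Howard 2004 Thm. 1.6.1 print-as-WORDED: every
DVR coefficient ring, every imaginary quadratic `K`) only in the shape `h161 p K R N Rk Nbar Nq S κ hy hlarge hone` with `R = Λ/(X^m + p)`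
(the Eisenstein DVR of `W.eisensteinDVRSetting`, characteristic `0`) and `K` the field of a μ-frame (`CastellaGrossiLeeSkinner2022.Thm413Hypotheses`:
`p` odd, `d_K` odd, `d_K ≠ −3`, so `d_K < −4` and `#𝓞_K^× = 2`). The print-as-INTENDED leaf F-161′
`Howard2004.thm161_dvrKolyvaginBound_printIntended` (lit g45, 2026-08-29) carries the two guards `((p : ℕ) : R) ≠ 0` and
`¬ p ∣ Nat.card (𝓞 K)ˣ` under which print's proof (and the cell's G87 ENGINE road) runs. This file shows the guards cost the KS-road
consumers NOTHING: each theorem that took `h161 : thm161_dvrKolyvaginBound` is re-derived VERBATIM from F-161′, the two guards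
discharged at the application site by `IwasawaAlgebra.natCast_quotient_X_pow_add_C_ne_zero` (hp0) and
`card_units_eq_two_of_discr_lt` ∘ `IsImaginaryQuadratic.discr_lt_neg_four_of_odd` (hu).

* `portCyclic_of_ks_intended` — KS-twin cyclic port `HeegnerMuPartOfPrintKS.portCyclic_of_ks` (bsd-line-x10b-p1 LEAD g10) with `h161`
  replaced by `hH' : thm161_dvrKolyvaginBound_printIntended`; proof verbatim but for the two guard lines.
* `muPartStabilizedCoherentPair_of_howardIntended_thm411_ks` / `muPartStabilizedCoherentPair_of_howardIntended_thm411` — the L∃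
  letter `HeegnerMuPartStabilized.MuPartStabilizedCoherentPair` (= the text of crux stmt-BirchSwinnertonDyer-22642) from F-161′ + F-411
  (+ the frame-restricted Kummer = strict theorem, discharged by `kummerStrictOnFrames_holds` in the second). Twin of
  `HeegnerMuPartOfPrintKSClosed.muPartStabilizedCoherentPair_of_thm161_thm411`.
* `exists_coherentPair_isTorsion_muIneq_of_howardIntended_kolyvaginSystem` — twin of x9-p1 LEAD g7's p689159 §2
  `HeegnerStabilizedOfKSLeaf.exists_coherentPair_isTorsion_muIneq_of_howard_kolyvaginSystem` (torsion DERIVED from rank one).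
* `…_of_thm161` sanity forms: F-161 ⟹ F-161′ (`thm161_dvrKolyvaginBound_printIntended_of_thm161`), so nothing here is weaker than
  what the tree had.
HONEST FRAMING: CONDITIONAL on F-161′ and F-411 (statement-only print leaves); credits nothing by itself — it is the consumer half of
REF-167 (ii); the day the ENGINE lands `thm161_dvrKolyvaginBound_printIntended` as a kernel theorem these become theorems modulo
F-411 and the engine's own cite-only inputs. «beyond-print theorem»: no. No summit statement is proved; thm161 is NOT proved; BSD is
NOT proved by any of this.

References: [Howard2004HeegnerKolyvagin] Thm. 1.6.1 (arXiv Thm. 2.6.1), p. 3 L23–25, p. 4 L47–51, §2.2 p. 6 L84–92;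
[CastellaGrossiLeeSkinner2022] Thm. 4.1.1, Rem. 4.1.4, §3.2; [GrossLMS1991] §1; [PerrinRiou1987BSMF] §3.4 Prop. 10.
-/

set_option linter.dupNamespace false
set_option autoImplicit false

noncomputable section

open scoped Classical Pointwise NumberField
open Field IsDedekindDomain NumberField
open Literature Literature.NumberTheory.EllipticCurves WeierstrassCurve
  Literature.NumberTheory.EllipticCurves.ModularForms
  Literature.NumberTheory.EllipticCurves.CastellaGrossiLeeSkinner2022
  Literature.NumberTheory.GaloisCohomology.Howard2004 Literature.NumberTheory.GaloisRepresentations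
open Summit.BirchSwinnertonDyer.BirchSwinnertonDyer.Theorems

namespace Summit.BirchSwinnertonDyer.BirchSwinnertonDyer.Theorems.HeegnerMuPartOfHowardIntended

/-! ## §0 The frame side of guard (hu) -/

/-- The frame side of guard (hu): on a μ-frame `d_K` is odd and `≠ −3`, so `d_K < −4`, `#𝓞_K^× = 2`, and `p` is odd.
[cite: CastellaGrossiLeeSkinner2022, §3.2 (hypotheses: p odd, d_K odd, ≠ −3)] [cite: GrossLMS1991, §1 (𝒪^× = ⟨±1⟩ for D ≠ 3, 4)] -/
theorem not_dvd_card_units_of_thm413Hypotheses {N : ℕ} [NeZero N] {W : WeierstrassCurve ℚ} [W.IsGloballyMinimal]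
    {K : Type} [Field K] [NumberField K] {p : ℕ} [Fact p.Prime] {κ : ZpExtension K p} {γ : Field.absoluteGaloisGroup K}
    (hyp : Thm413Hypotheses N W K p κ γ) : ¬ p ∣ Nat.card (𝓞 K)ˣ := by
  rw [card_units_eq_two_of_discr_lt hyp.isImaginaryQuadratic
    (hyp.isImaginaryQuadratic.discr_lt_neg_four_of_odd hyp.discr_odd hyp.discr_ne)]
  exact fun h ↦ hyp.p_ne_two ((Nat.prime_dvd_prime_iff_eq Fact.out Nat.prime_two).mp h)

/-! ## §1 The KS-twin cyclic port from F-161′ -/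

set_option synthInstance.maxHeartbeats 80000 in
/-- **The cyclic port statement from the kernel stub letters, GIVEN F-161′, CGLS's Thm. 4.1.1 and the
frame-restricted Kummer = strict letter** — `HeegnerMuPartOfPrintKS.portCyclic_of_ks` with `h161 : thm161_dvrKolyvaginBound`
replaced by `hH' : thm161_dvrKolyvaginBound_printIntended` (F-161′); proof verbatim except that Howard's conclusion is invoked with
the two guards `(p : Λ/(X^m+p)) ≠ 0` (`IwasawaAlgebra.natCast_quotient_X_pow_add_C_ne_zero`) and `p ∤ #𝓞_K^×` read off the frame.
[cite: Howard2004HeegnerKolyvagin, Thm. 1.6.1 and Thm. 2.2.10 (proof)] [cite: CastellaGrossiLeeSkinner2022, Thm. 4.1.1 and Rem. 4.1.4] -/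
theorem portCyclic_of_ks_intended (hH' : thm161_dvrKolyvaginBound_printIntended)
    (hK : thm411_exists_kolyvaginSystem_one_ne_zero)
    (hKS : HeegnerMuPartControlGlue.Stmt.kummerStrictOnFrames)
    (hA : HeegnerMuPartStubA.Stmt.howardInputs) (hB : HeegnerMuPartControlGlue.Stmt.controlGlueKS) :
    ∀ (N : ℕ) [NeZero N] (W : WeierstrassCurve ℚ) [W.IsGloballyMinimal] (K : Type) [Field K] [NumberField K]
      (p : ℕ) [Fact p.Prime] (κ : ZpExtension K p) (γ : Field.absoluteGaloisGroup K)
      (jbar : AlgebraicClosure K →+* ℂ),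
      Thm413Hypotheses N W K p κ γ →
      ¬ W.HasCM → W.HasIrreducibleModPGaloisRep p → (W.baseChange K).HasIrreducibleModPGaloisRep p →
      MastellaZerman2026.HasPadicScalarImage W p → SatisfiesHeegnerHypothesis p K →
      p ∣ NumberField.classNumber K →
      ∀ (D : (W.baseChange K).LambdaAdicSelmerData κ γ)
        (C : StabilizedHeegnerData N W K κ jbar)
        (X : (W.baseChange K).SelmerDualData κ γ) (z : D.S),
      (∀ (k : ℕ) (hk : C.depth < k), D.proj k z ∈ stabilizedClassLayer C k hk) →
      stabilizedHeegnerModule D C = Submodule.span (IwasawaAlgebra p) {z} →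
      Module.Finite (IwasawaAlgebra p) D.S → Module.Finite (IwasawaAlgebra p) X.X →
      Module.IsTorsion (IwasawaAlgebra p) (D.S ⧸ stabilizedHeegnerModule D C) →
      HeegnerMuPartStabilized.HasSpecWitnesses p D.S X.X (stabilizedHeegnerModule D C) := by
  intro N _ W _ K _ _ p _ κ γ jbar hyp hCM hirr hirrK hsc hHp hhK D C X z hz hcyc hfinS hfinX htor
  have hu : ¬ p ∣ Nat.card (𝓞 K)ˣ := not_dvd_card_units_of_thm413Hypotheses hyp
  obtain ⟨m₀, hA⟩ := hA hK N W K p κ γ jbar hyp hCM hirr hirrK hsc hHp hhK D C X z hz hcyc hfinS hfinX htor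
  -- `z ≠ 0` from STUB A at the level `max m₀ 1`: the Kolyvagin system's bottom class is `ctrlLevel … z`, non-zero
  have hz0 : z ≠ 0 := by
    have hm' : 1 ≤ max m₀ 1 := le_max_right _ _
    haveI := hyp.isElliptic
    letI := IwasawaAlgebra.isDomain_quotient_X_pow_add_C p hm'
    letI := IwasawaAlgebra.isDiscreteValuationRing_quotient_X_pow_add_C p hm'
    haveI := IwasawaAlgebra.EisensteinCoeff.isLocalRing_succ p hm'
    letI := IwasawaAlgebra.EisensteinCoeff.algebraOfSpecSucc p (max m₀ 1)
    haveI := W.isScalarTower_algebraOfSpecSucc (K := K) (p := p) (m := max m₀ 1)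
    letI := W.residueModuleSucc (K := K) (p := p) hm'
    obtain ⟨_S₀, _hpS₀, _hbad₀, _hSN₀, _hSσ₀, _L₀, _hL₀, _hLS₀, _jbar₀, _cd₀, _Dd₀, _fs₀, _t₀, _ht₀, _I₀, _hy₀, κ₀, _hlarge₀,
      hone₀, hlink₀⟩ := hA (max m₀ 1) hm' (le_max_left _ _)
    intro hz
    subst hz
    exact hone₀ (funext fun k ↦ by
      rw [hlink₀ k, Pi.zero_apply, map_zero, map_zero]
      rfl)
  obtain ⟨c, m₁, hB⟩ :=
    hB hKS N W K p κ γ jbar hyp hCM hirr hirrK hsc hHp hhK D C X z hz hcyc hfinS hfinX htor hz0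
  refine ⟨c, max (max m₀ m₁) 1, fun m hm' ↦ ?_⟩
  have hm : 1 ≤ m := le_trans (le_max_right _ _) hm'
  have hm0 : m₀ ≤ m := le_trans ((le_max_left _ _).trans (le_max_left _ _)) hm'
  have hm1 : m₁ ≤ m := le_trans ((le_max_right _ _).trans (le_max_left _ _)) hm'
  haveI := hyp.isElliptic
  letI := IwasawaAlgebra.isDomain_quotient_X_pow_add_C p hm
  letI := IwasawaAlgebra.isDiscreteValuationRing_quotient_X_pow_add_C p hm
  haveI := IwasawaAlgebra.EisensteinCoeff.isLocalRing_succ p hm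
  letI := IwasawaAlgebra.EisensteinCoeff.algebraOfSpecSucc p m
  haveI := W.isScalarTower_algebraOfSpecSucc (K := K) (p := p) (m := m)
  letI := W.residueModuleSucc (K := K) (p := p) hm
  obtain ⟨S, hpS, hbad, hSN, hSσ, L, hL, hLS, jbar', cd, Dd, fs, t, ht, I, hy, κKS, hlarge, hone, hlink⟩ := hA m hm hm0
  have hconc := hH' p K _ _ _ _ _ (W.eisensteinDVRSetting (κ.unitTwist (-1)) hm S hpS hbad L hL hLS jbar' cd Dd fs)
    κKS hy (IwasawaAlgebra.natCast_quotient_X_pow_add_C_ne_zero p hm) hu hlarge hone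
  have hone_eq : κKS.one =
      fun k ↦ I.proj (k + 1) (D.toEisensteinH1Linear hm t ht I hyp.topGenerator hyp.noPTorsion z) :=
    funext hlink
  rw [hone_eq] at hconc
  exact hB m hm hm1 S hpS hbad hSN hSσ L hL hLS jbar' cd Dd fs t ht I hy hconc

/-! ## §2 The L∃ letter (crux 22642's text) from F-161′ + F-411 -/

/-- **Route-free KS form from F-161′**: F-161′ ⟹ CGLS Thm. 4.1.1 ⟹ the frame-restricted
Kummer = strict letter ⟹ `MuPartStabilizedCoherentPair`, from the kernel stub letters `howardInputs`, `controlGlueKS` (cyclic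
port engine `HeegnerMuPartStabilized.muPartStabilizedCoherentPair_of_forall_cyclic`).
[cite: Howard2004HeegnerKolyvagin, Thm. 1.6.1 and Thm. 2.2.10 (proof)] [cite: CastellaGrossiLeeSkinner2022, Thm. 4.1.1] -/
theorem muPartStabilizedCoherentPair_of_howardIntended_thm411_ks (hA : HeegnerMuPartStubA.Stmt.howardInputs)
    (hB : HeegnerMuPartControlGlue.Stmt.controlGlueKS) :
    thm161_dvrKolyvaginBound_printIntended → thm411_exists_kolyvaginSystem_one_ne_zero →
      HeegnerMuPartControlGlue.Stmt.kummerStrictOnFrames → HeegnerMuPartStabilized.MuPartStabilizedCoherentPair :=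
  fun hH' hK hKS ↦
    HeegnerMuPartStabilized.muPartStabilizedCoherentPair_of_forall_cyclic (portCyclic_of_ks_intended hH' hK hKS hA hB)

/-- **The L∃ letter `MuPartStabilizedCoherentPair` (the text of the shared μ-crux stmt-BirchSwinnertonDyer-22642) from the
GUARDED letter and F-411 alone** — the stub letters and the Kummer = strict letter being kernel theorems
(`HeegnerMuPartOfPrintKSClosed.howardInputs_holds` / `controlGlueKS_holds`, `HeegnerMuPartControlGlue.kummerStrictOnFrames_holds`).
Twin of `HeegnerMuPartOfPrintKSClosed.muPartStabilizedCoherentPair_of_thm161_thm411`.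
[cite: Howard2004HeegnerKolyvagin, Thm. 1.6.1] [cite: CastellaGrossiLeeSkinner2022, Thm. 4.1.1, Rem. 4.1.4] -/
theorem muPartStabilizedCoherentPair_of_howardIntended_thm411 :
    thm161_dvrKolyvaginBound_printIntended → thm411_exists_kolyvaginSystem_one_ne_zero →
      HeegnerMuPartStabilized.MuPartStabilizedCoherentPair :=
  fun hH' hK ↦ muPartStabilizedCoherentPair_of_howardIntended_thm411_ks HeegnerMuPartOfPrintKSClosed.howardInputs_holds
    HeegnerMuPartOfPrintKSClosed.controlGlueKS_holds hH' hK HeegnerMuPartControlGlue.kummerStrictOnFrames_holds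

/-! ## §3 The coherent-pair μ-letter with torsion DERIVED, from F-161′ + F-411 -/

/-- **Twin of `HeegnerStabilizedOfKSLeaf.exists_coherentPair_isTorsion_muIneq_of_howard_kolyvaginSystem` (p689159 §2) from the
GUARDED letter**: on every μ-frame (binder prefix of `MuPartStabilizedCoherentPair` verbatim) THERE ARE a stabilised datum `C`
and a Howard family `F` on `(Dt, β)` with the engine's envelopes such that `Λ`-rank one of `𝔖` gives `𝔖` torsion-free and
`𝔖/Λκ_∞(C)` torsion, and rank one + finiteness give `length_(p)(𝒳_tors) ≤ 2·length_(p)(𝔖/Λκ_∞(C))`. Proof verbatim with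
`portCyclic_of_ks_intended` for `portCyclic_of_ks`. CONDITIONAL on F-161′ and F-411.
[cite: Howard2004HeegnerKolyvagin, Thm. 1.6.1 and proof of Thm. 2.2.10 (𝔮 = T^m + p)]
[cite: CastellaGrossiLeeSkinner2022, Thm. 4.1.1 and Rem. 4.1.4] [cite: PerrinRiou1987BSMF, §3.4 Prop. 10] -/
theorem exists_coherentPair_isTorsion_muIneq_of_howardIntended_kolyvaginSystem
    (hH' : thm161_dvrKolyvaginBound_printIntended) (hKS : thm411_exists_kolyvaginSystem_one_ne_zero) :
    ∀ (N : ℕ) [NeZero N] (W : WeierstrassCurve ℚ) [W.IsGloballyMinimal] (K : Type) [Field K] [NumberField K]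
      (p : ℕ) [Fact p.Prime] (κ : ZpExtension K p) (γ : Field.absoluteGaloisGroup K)
      (jbar : AlgebraicClosure K →+* ℂ),
      Thm413Hypotheses N W K p κ γ →
      ¬ W.HasCM → W.HasIrreducibleModPGaloisRep p → (W.baseChange K).HasIrreducibleModPGaloisRep p →
      MastellaZerman2026.HasPadicScalarImage W p → SatisfiesHeegnerHypothesis p K →
      p ∣ NumberField.classNumber K →
      ¬ p ∣ N →
      (∀ k, ringClassSubgroup K (p ^ (k + 1)) jbar ≤ κ.layerSubgroup k) →
      Nat.card (ringClassGalOver (jbar.comp (algebraMap K (AlgebraicClosure K))) p 1) = p - 1 →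
      ∀ (Dt : ModularParametrizationData W N) (β : ℤ), (4 * N : ℤ) ∣ β ^ 2 - NumberField.discr K →
      ∀ (D : (W.baseChange K).LambdaAdicSelmerData κ γ) (X : (W.baseChange K).SelmerDualData κ γ),
      ∃ (C : StabilizedHeegnerData N W K κ jbar) (F : HeegnerFamily N W K κ jbar),
        C.Dt = Dt ∧ F.Dt = Dt ∧ C.β = β ∧ F.β = β ∧
        heegnerModule D F ≤ stabilizedHeegnerModule D C ∧
        (∃ g : IwasawaAlgebra p, g ≠ 0 ∧ g • stabilizedHeegnerModule D C ≤ heegnerModule D F) ∧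
        (Module.Finite (IwasawaAlgebra p) D.S → Module.finrank (IwasawaAlgebra p) D.S = 1 →
          NoZeroSMulDivisors (IwasawaAlgebra p) D.S ∧
            Module.IsTorsion (IwasawaAlgebra p) (D.S ⧸ stabilizedHeegnerModule D C)) ∧
        (Module.Finite (IwasawaAlgebra p) D.S → Module.Finite (IwasawaAlgebra p) X.X →
          Module.finrank (IwasawaAlgebra p) D.S = 1 →
          ∀ 𝔭 : PrimeSpectrum (IwasawaAlgebra p), 𝔭.asIdeal = Ideal.span {(p : IwasawaAlgebra p)} →
            Module.lengthAt (IwasawaAlgebra p) (Submodule.torsion (IwasawaAlgebra p) X.X) 𝔭 ≤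
              2 * Module.lengthAt (IwasawaAlgebra p) (D.S ⧸ stabilizedHeegnerModule D C) 𝔭) := by
  intro N _ W _ K _ _ p _ κ γ jbar hyp hCM hirr hirrK hsc hHp hhK hpN hTw1 hcardp Dt β hβ D X
  have hlev : N = W.conductorNorm ℤ := hyp.level
  subst hlev
  haveI : W.IsElliptic := hyp.isElliptic
  -- the engine's coherent pair `(C, F)` on `(Dt, β)` WITH its class `z = κ_∞`
  obtain ⟨C, F, hCDt, hFDt, hCβ, hFβ, hfwd, hrev, z, hz, hcyc⟩ :=
    exists_coherent_pair_envelope_class (W := W) hyp.isImaginaryQuadratic hyp.heegner Dt hβ jbar hyp.ordinary hpN κ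
      hyp.topGenerator hTw1 hcardp hyp.noPTorsion D
  refine ⟨C, F, hCDt, hFDt, hCβ, hFβ, hfwd, hrev, fun hfinS hS1 ↦ ?_, fun hfinS hfinX hS1 𝔭 h𝔭 ↦ ?_⟩
  · haveI := hfinS
    exact HeegnerStabilizedOfKSLeaf.torsionFree_and_isTorsion_quotient_of_kolyvaginSystemLeaf hKS hyp jbar D C hz hcyc hS1
  · haveI := hfinS
    haveI := hfinX
    obtain ⟨-, htorC⟩ :=
      HeegnerStabilizedOfKSLeaf.torsionFree_and_isTorsion_quotient_of_kolyvaginSystemLeaf hKS hyp jbar D C hz hcyc hS1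
    -- the specialised witnesses at `(D, C, X, κ_∞)` from the F-161′ KS-port and the kernel letters of CG-FRAME
    have hW := portCyclic_of_ks_intended hH' hKS HeegnerMuPartControlGlue.kummerStrictOnFrames_holds
      HeegnerMuPartOfPrintKSClosed.howardInputs_holds HeegnerMuPartOfPrintKSClosed.controlGlueKS_holds
      (W.conductorNorm ℤ) W K p κ γ jbar hyp hCM hirr hirrK hsc hHp hhK D C X z hz hcyc hfinS hfinX htorC
    exact HeegnerMuPartStabilized.lengthAt_torsion_le_two_mul_of_hasSpecWitnesses p _ htorC hW 𝔭 h𝔭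

/-! ## §4 Sanity: the F-161 forms follow from these (F-161 ⟹ F-161′) -/

/-- `HeegnerMuPartOfPrintKSClosed.muPartStabilizedCoherentPair_of_thm161_thm411` recovered from §2 through F-161 ⟹ F-161′
(`thm161_dvrKolyvaginBound_printIntended_of_thm161`): this file generalises the KS road, it does not weaken it.
[cite: Howard2004HeegnerKolyvagin, Thm. 1.6.1] [cite: CastellaGrossiLeeSkinner2022, Thm. 4.1.1] -/
theorem muPartStabilizedCoherentPair_of_thm161_thm411' :
    thm161_dvrKolyvaginBound → thm411_exists_kolyvaginSystem_one_ne_zero →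
      HeegnerMuPartStabilized.MuPartStabilizedCoherentPair :=
  fun h161 ↦ muPartStabilizedCoherentPair_of_howardIntended_thm411 (thm161_dvrKolyvaginBound_printIntended_of_thm161 h161)

end Summit.BirchSwinnertonDyer.BirchSwinnertonDyer.Theorems.HeegnerMuPartOfHowardIntended

end
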